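import Summits.QuantumFields.YangMills.Theorems.UnitScaleTiltCoverSites
import Summits.QuantumFields.YangMills.Theorems.UnitScaleTiltCoverStencils
import Summits.QuantumFields.YangMills.Theorems.UnitScaleTiltCoverAdjoint
import Literature.MathematicalPhysics.QuantumFieldTheory.Balaban1983to89.B6SectAOperatorsV1
import HarnessLib

/-!
# Route `UnitScaleTilt`, crux K1 child «MinimiserStabilityRegPr» (stmt-QuantumFields-19200), registered stub `stub_halvingStep` (H), branch (P2-small),
# mechanism of record **(α) COVERING ∕ PERIODISATION** (OWNER RULING g26-№18) — brick (A) `CoverPullback`: **THE `ℓ²` PULLBACKS ALONG THE COVERING MAP AND THEIR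
# ADJOINTS (FIBRE SUMS); `∂`, `∂*`, curl, `Δ` AND `∂* = curl†` OF [Balaban1984PropagatorsII] SECT. A INTERTWINE WITH THE PULLBACK** (the `h1 = ∂*∂` summand of (2.19))

Cell `ym3-torus` (HUMAN RULING D-0037, YM ladder rung R3 — continuum SU(2) YM₃ on the torus is a RUNG, not the Clay problem), width seat `ym-ust-20520-w1` gen 5,
following LEAD `ym-ust-19200-w5` g3's FINAL HANDOFF § (cell HANDOFF.md) by name.  `--supports stmt-QuantumFields-19200 --as helper`; def-free, 0 sorry, standard axioms.

THE POINT.  The key lemma of the branch, `flatH D̃ (X ∘ projIdx) = (flatH D X) ∘ projBond` (file (C) `CoverFlatH`), is ✓`CoverFlatOps.hOp_intertwine` (α4-core) once the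
three LOCAL blocks `Δ_a = ∂*∂ + ∂R∂* + Q*aQ`, `Q`, `Q*` of (2.19)–(2.20) intertwine with the pullbacks
`πB := onE (LinearMap.funLeft ℝ ℝ (projBond P jc 0))` (bonds), `πS` (sites), `πP` (plaquettes), `πI` (index bonds).  THIS FILE: the Hilbert-space side.
* §1 GENERIC (any map `ψ` of finite types): `onE_funLeft_apply` (`(π x) a = x (ψ a)`), ★`adjoint_onE_funLeft_apply` — THE ADJOINT OF A PULLBACK IS THE FIBRE SUM
  `(π† g) b = Σ_{a : ψ a = b} g a` (LEAD's subtype-sum convention of ✓`CoverStencils`), `inner_onE_funLeft_left` (`⟪π f, g⟫ = ⟪f, π† g⟫`).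
* §2 AT THE COVER (`φ := proj P jc 0`, `hd = rfl`, `hs∕hu` = ✓`proj_shift∕proj_unshift`): `dE_pull`, `dsE_pull`, `dcE_pull`, `lapE_pull` (✓`grad_comp`∕`diverg_comp`∕
  `curl_comp`∕`laplace_comp`), `dcE_push`, `lapE_push` (✓`curl_push`∕`laplace_push` read on the adjoints), ★`dcsE_pull : dcsE c (πP g) = πB (dcsE c g)`
  (✓`CoverFlatOps.adjoint_intertwine_of_push`), ★`h1_pull : (dcsE c ∘ₗ dcE c) (πB u) = πB ((dcsE c ∘ₗ dcE c) u)` — the first hypothesis of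
  ✓`CoverFlatOps.deltaAE_intertwine_of_summands` at the cover.
HONEST SCOPE: linear bookkeeping; no estimate; (B) `CoverGaugeFix` (`R`, `Q′`) and (C) `CoverFlatH` (`Q`, `Q*`, `a`, assembly) follow.  NOT a claim about the H stub, the
crux, the rung or a mass gap.

References: T. Bałaban, CMP **96** (1984) 223–250 [Balaban1984PropagatorsII] (2.5)–(2.8) p.224, (2.18)–(2.20) p.226; CMP **95** (1984) 17–40 [Balaban1984PropagatorsI]
(1.2)–(1.4) p.18, (1.21) p.21.
-/

set_option autoImplicit false

noncomputable section

open scoped BigOperators InnerProductSpace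

namespace Summit.QuantumFields.YangMills.Theorems.CoverPullback

open Literature.MathematicalPhysics.QuantumFieldTheory.Balaban1983to89
open LatticeFieldCalculus (grad diverg curl laplace)
open B6SectAOperatorsV1 (onE ScalarSpace dE dsE dcE dcsE lapE inner_eq_sum)
open Literature.MathematicalPhysics.QuantumFieldTheory.BalabanImbrieJaffe1984to88.BIJ85AxialPropagator411 (BondSpace PlaqSpace)
open CoverSites (cover proj projBond projPlaq proj_shift proj_unshift)
open CoverStencils (grad_comp diverg_comp curl_comp laplace_comp curl_push laplace_push)
open CoverFlatOps (adjoint_intertwine_of_push)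

/-! ## §1 Generic: pullback along a map of finite types, and its adjoint -/

section Generic

variable {α β : Type*} [Fintype α] [Fintype β]

omit [Fintype α] [Fintype β] in
/-- the pullback `x ↦ x ∘ ψ` read on `ℓ²`: `(π x)(a) = x(ψ a)`. [cite: Balaban1984PropagatorsII, (2.8) p.224] -/
theorem onE_funLeft_apply (ψ : α → β) (x : EuclideanSpace ℝ β) (a : α) : onE (LinearMap.funLeft ℝ ℝ ψ) x a = x (ψ a) := rfl

/-- **THE ADJOINT OF THE PULLBACK IS THE FIBRE SUM**: `(π† g)(b) = Σ_{a : ψ a = b} g(a)`. [cite: Balaban1984PropagatorsII, (2.8) p.224, (2.18) p.226] -/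
theorem adjoint_onE_funLeft_apply [DecidableEq β] (ψ : α → β) (g : EuclideanSpace ℝ α) (b : β) :
    LinearMap.adjoint (onE (LinearMap.funLeft ℝ ℝ ψ)) g b = ∑ a : {a // ψ a = b}, g a.1 := by
  have h1 : LinearMap.adjoint (onE (LinearMap.funLeft ℝ ℝ ψ)) g b =
      ⟪EuclideanSpace.single b (1 : ℝ), LinearMap.adjoint (onE (LinearMap.funLeft ℝ ℝ ψ)) g⟫_ℝ := by
    rw [EuclideanSpace.inner_single_left, map_one, one_mul]
  rw [h1, LinearMap.adjoint_inner_right, inner_eq_sum]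
  simp only [onE_funLeft_apply, EuclideanSpace.single, PiLp.single_apply]
  rw [show (∑ a : α, (if ψ a = b then (1 : ℝ) else 0) * g a) = ∑ a ∈ Finset.univ.filter (fun a => ψ a = b), g a by
    rw [Finset.sum_filter]
    exact Finset.sum_congr rfl fun a _ => by split_ifs <;> simp]
  exact Finset.sum_subtype _ (fun a => by simp) _

/-- `⟪π f, g⟫ = ⟪f, π† g⟫` (the pullback∕fibre-sum adjointness in the shape of ✓`CoverFlatOps.adjoint_intertwine_of_push`'s `h₁`). [cite: Balaban1984PropagatorsII, (2.8) p.224] -/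
theorem inner_onE_funLeft_left (ψ : α → β) (f : EuclideanSpace ℝ β) (g : EuclideanSpace ℝ α) :
    ⟪onE (LinearMap.funLeft ℝ ℝ ψ) f, g⟫_ℝ = ⟪f, LinearMap.adjoint (onE (LinearMap.funLeft ℝ ℝ ψ)) g⟫_ℝ :=
  (LinearMap.adjoint_inner_right _ _ _).symm

/-- the fibre sum as a function: `ofLp (π† g) = fun b ↦ Σ_{a : ψ a = b} g a`. [cite: Balaban1984PropagatorsII, (2.8) p.224] -/
theorem ofLp_adjoint_onE_funLeft [DecidableEq β] (ψ : α → β) (g : EuclideanSpace ℝ α) :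
    WithLp.ofLp (LinearMap.adjoint (onE (LinearMap.funLeft ℝ ℝ ψ)) g) = fun b => ∑ a : {a // ψ a = b}, g a.1 :=
  funext fun b => adjoint_onE_funLeft_apply ψ g b

end Generic

/-! ## §2 At the cover: `∂`, `∂*`, curl, `Δ` and `∂* = curl†` intertwine with the pullbacks -/

section Cover

variable (P : Params) (jc : ℕ) (c : ℝ)

/-- `(cover P jc).d = P.d` definitionally (`cover` is an `abbrev`), in the shape ✓`CoverStencils` consumes. [cite: Balaban1987RG1, (0.1) p.251] -/
theorem cover_d_eq : (cover P jc).d = P.d := rfl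

/-- `proj` commutes with `+e_μ`, in ✓`CoverStencils`' `hs` shape. [cite: Balaban1987RG1, (0.1) p.251] -/
theorem hs_proj : ∀ (x : Site (cover P jc) 0) (μ : Fin (cover P jc).d), proj P jc 0 (x.shift μ) = (proj P jc 0 x).shift (Fin.cast (cover_d_eq P jc) μ) :=
  fun x μ => proj_shift P jc 0 x μ

/-- `proj` commutes with `−e_μ`, in ✓`CoverStencils`' `hu` shape. [cite: Balaban1987RG1, (0.1) p.251] -/
theorem hu_proj : ∀ (x : Site (cover P jc) 0) (μ : Fin (cover P jc).d), proj P jc 0 (x.unshift μ) = (proj P jc 0 x).unshift (Fin.cast (cover_d_eq P jc) μ) :=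
  fun x μ => proj_unshift P jc 0 x μ

/-- the bond pullback of a bond function IS ✓`CoverStencils`' `fun b′ ↦ A ⟨φ b′.src, Fin.cast hd b′.dir⟩`. [cite: Balaban1985Averaging, (5) p.18] -/
theorem projBond_eq_stencil (b : PBond (cover P jc) 0) : projBond P jc 0 b = ⟨proj P jc 0 b.src, Fin.cast (cover_d_eq P jc) b.dir⟩ := rfl

/-- the plaquette pullback likewise. [cite: Balaban1985Averaging, (5) p.18] -/
theorem projPlaq_eq_stencil (p : Plaq (cover P jc) 0) :
    projPlaq P jc 0 p = ⟨proj P jc 0 p.src, Fin.cast (cover_d_eq P jc) p.μ, Fin.cast (cover_d_eq P jc) p.ν, Fin.lt_def.mpr (Fin.lt_def.mp p.hμν)⟩ := rfl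

/-- **`∂` INTERTWINES WITH THE PULLBACKS**: `∂(πS f) = πB(∂f)`. [cite: Balaban1984PropagatorsII, (2.7) p.224] -/
theorem dE_pull (f : ScalarSpace P) :
    dE c (onE (LinearMap.funLeft ℝ ℝ (proj P jc 0)) f) = onE (LinearMap.funLeft ℝ ℝ (projBond P jc 0)) (dE c f) := by
  ext b
  rw [B6SectAOperatorsV1.dE_apply, onE_funLeft_apply, B6SectAOperatorsV1.dE_apply]
  exact grad_comp (cover_d_eq P jc) (proj P jc 0) (hs_proj P jc) c (WithLp.ofLp f) b

/-- **`∂*` INTERTWINES WITH THE PULLBACKS**: `∂*(πB u) = πS(∂*u)`. [cite: Balaban1984PropagatorsII, (2.8) p.224] -/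
theorem dsE_pull (u : BondSpace P) :
    dsE c (onE (LinearMap.funLeft ℝ ℝ (projBond P jc 0)) u) = onE (LinearMap.funLeft ℝ ℝ (proj P jc 0)) (dsE c u) := by
  ext x
  rw [B6SectAOperatorsV1.dsE_apply, onE_funLeft_apply, B6SectAOperatorsV1.dsE_apply]
  exact diverg_comp (cover_d_eq P jc) (proj P jc 0) (hu_proj P jc) c (WithLp.ofLp u) x

/-- **curl INTERTWINES WITH THE PULLBACKS**: `curl(πB u) = πP(curl u)`. [cite: Balaban1984PropagatorsII, (2.5) p.224] -/
theorem dcE_pull (u : BondSpace P) :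
    dcE c (onE (LinearMap.funLeft ℝ ℝ (projBond P jc 0)) u) = onE (LinearMap.funLeft ℝ ℝ (projPlaq P jc 0)) (dcE c u) := by
  ext p
  rw [B6SectAOperatorsV1.dcE_apply, onE_funLeft_apply, B6SectAOperatorsV1.dcE_apply]
  exact curl_comp (cover_d_eq P jc) (proj P jc 0) (hs_proj P jc) c (WithLp.ofLp u) p

/-- **`Δ = ∂*∂` INTERTWINES WITH THE PULLBACK**: `Δ(πS f) = πS(Δf)`. [cite: Balaban1984PropagatorsII, (2.8) p.224] -/
theorem lapE_pull (f : ScalarSpace P) :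
    lapE c (onE (LinearMap.funLeft ℝ ℝ (proj P jc 0)) f) = onE (LinearMap.funLeft ℝ ℝ (proj P jc 0)) (lapE c f) := by
  rw [lapE, LinearMap.comp_apply, dE_pull, dsE_pull]
  rfl

/-- **curl INTERTWINES WITH THE FIBRE SUMS** (the adjoints of the pullbacks): `curl(πB† v) = πP†(curl v)`. [cite: Balaban1984PropagatorsII, (2.5) p.224] -/
theorem dcE_push (v : BondSpace (cover P jc)) :
    dcE c (LinearMap.adjoint (onE (LinearMap.funLeft ℝ ℝ (projBond P jc 0))) v) =
      LinearMap.adjoint (onE (LinearMap.funLeft ℝ ℝ (projPlaq P jc 0))) (dcE c v) := by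
  classical
  ext p
  obtain ⟨x, μ, ν, hμν⟩ := p
  rw [B6SectAOperatorsV1.dcE_apply, ofLp_adjoint_onE_funLeft, adjoint_onE_funLeft_apply]
  have h : curl c (fun b : PBond P 0 => ∑ b' : {b' : PBond (cover P jc) 0 // projBond P jc 0 b' = b}, (WithLp.ofLp v) b'.1) ⟨x, μ, ν, hμν⟩ =
      ∑ p' : {p' : Plaq (cover P jc) 0 // projPlaq P jc 0 p' = ⟨x, μ, ν, hμν⟩}, curl c (WithLp.ofLp v) p'.1 :=
    curl_push (cover_d_eq P jc) (proj P jc 0) (hs_proj P jc) (hu_proj P jc) c (WithLp.ofLp v) x μ ν hμν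
  exact h

/-- **`Δ` INTERTWINES WITH THE FIBRE SUMS**: `Δ(πS† s) = πS†(Δ s)`. [cite: Balaban1984PropagatorsII, (2.8) p.224] -/
theorem lapE_push (s : ScalarSpace (cover P jc)) :
    lapE c (LinearMap.adjoint (onE (LinearMap.funLeft ℝ ℝ (proj P jc 0))) s) =
      LinearMap.adjoint (onE (LinearMap.funLeft ℝ ℝ (proj P jc 0))) (lapE c s) := by
  classical
  ext x
  rw [B6SectAOperatorsV1.lapE_apply, ofLp_adjoint_onE_funLeft, adjoint_onE_funLeft_apply]
  simp only [B6SectAOperatorsV1.lapE_apply]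
  exact laplace_push (cover_d_eq P jc) (proj P jc 0) (hs_proj P jc) (hu_proj P jc) c (WithLp.ofLp s) x

/-- ★ **`∂* = curl†` INTERTWINES WITH THE PULLBACKS**: `∂*(πP g) = πB(∂* g)` — adjoints intertwine with pullbacks because curl intertwines with the fibre sums
(✓`CoverFlatOps.adjoint_intertwine_of_push`). [cite: Balaban1984PropagatorsII, (2.19) p.226] -/
theorem dcsE_pull (g : PlaqSpace P) :
    dcsE c (onE (LinearMap.funLeft ℝ ℝ (projPlaq P jc 0)) g) = onE (LinearMap.funLeft ℝ ℝ (projBond P jc 0)) (dcsE c g) :=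
  adjoint_intertwine_of_push (dcE (P := P) c) (dcE (P := cover P jc) c)
    (onE (LinearMap.funLeft ℝ ℝ (projBond P jc 0))) (onE (LinearMap.funLeft ℝ ℝ (projPlaq P jc 0)))
    (LinearMap.adjoint (onE (LinearMap.funLeft ℝ ℝ (projBond P jc 0)))) (LinearMap.adjoint (onE (LinearMap.funLeft ℝ ℝ (projPlaq P jc 0))))
    (inner_onE_funLeft_left _) (inner_onE_funLeft_left _) (dcE_push P jc c) g

/-- ★ **`h1`: `∂*∂` INTERTWINES WITH THE BOND PULLBACK** — the first hypothesis of ✓`CoverFlatOps.deltaAE_intertwine_of_summands` at the cover.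
[cite: Balaban1984PropagatorsII, (2.19) p.226] -/
theorem h1_pull (u : BondSpace P) :
    (dcsE c ∘ₗ dcE c) (onE (LinearMap.funLeft ℝ ℝ (projBond P jc 0)) u) = onE (LinearMap.funLeft ℝ ℝ (projBond P jc 0)) ((dcsE c ∘ₗ dcE c) u) := by
  rw [LinearMap.comp_apply, LinearMap.comp_apply, dcE_pull, dcsE_pull]

/-- `∂ ∘ (anything intertwining on sites) ∘ ∂*`: if `T̃ (πS s) = πS (T s)` then `(∂ T̃ ∂*)(πB u) = πB ((∂ T ∂*) u)` — the shape of the second summand `∂R∂*` of (2.19),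
with `R` supplied by file (B). [cite: Balaban1984PropagatorsII, (2.19) p.226] -/
theorem h2_pull_of (T : ScalarSpace P →ₗ[ℝ] ScalarSpace P) (T' : ScalarSpace (cover P jc) →ₗ[ℝ] ScalarSpace (cover P jc))
    (hT : ∀ s, T' (onE (LinearMap.funLeft ℝ ℝ (proj P jc 0)) s) = onE (LinearMap.funLeft ℝ ℝ (proj P jc 0)) (T s)) (u : BondSpace P) :
    (dE c ∘ₗ T' ∘ₗ dsE c) (onE (LinearMap.funLeft ℝ ℝ (projBond P jc 0)) u) = onE (LinearMap.funLeft ℝ ℝ (projBond P jc 0)) ((dE c ∘ₗ T ∘ₗ dsE c) u) := by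
  simp only [LinearMap.comp_apply]
  rw [dsE_pull, hT, dE_pull]

end Cover

end Summit.QuantumFields.YangMills.Theorems.CoverPullback

end
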